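import Summits.QuantumFields.BalabanUV.Beta.FP.ColourDoublingBlocks

/-!
# `BalabanUV.Beta.FP.NestedStepLawOneShotJetsGraded` — road «FP» for binder row D1, ROUTE T, option (δ) «LIFT» (R-FP-54′):
# **THE ONE-SHOT-SLICED COMPOSITE STEP LAW FOR GRADED (COLOUR-STRIPPED) 2-JETS** — p308750 `secondVar_oneShot_nestedStepLaw_jets` read
# through the antisymmetric colour lift `D1BFx.ColourLift` and stripped back: ONE-SIDED graded Ward letters only, odd bordered jets (−)-placed

WHY (F-FP-18-2 ∕ F-FP-18-3; an3 g95 W-1: the (−) placement is the convention of record, `StepJetData` §5 `mfNeg`).  For the colour-stripped literal the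
first-order tables are ANTISYMMETRIC, so p308750's two-sided letters `a0t a1t a2t` cannot be fed un-lifted.  Here p308750 is instantiated at the LIFTED
objects `1 ⊗ X₀`, `c ⊗ X₁`, `(c·c) ⊗ X₂` (`cᵀ = −c`, `tr(c·c) ≠ 0`; index types `l × ·`), every lifted hypothesis is DERIVED from a GRADED one-sided
stripped hypothesis by Kronecker bookkeeping (`ColourDoublingBlocks`), the two-sided letters come for free from the parities `𝔎₀ᵀ = 𝔎₀`, `𝔎₁ᵀ = −𝔎₁`, `𝔎₂ᵀ = 𝔎₂`, and the
lifted conclusion is stripped back by `ColourDoublingKkt.secondVar_kkt_lift_strip` (uniform factor `tr(c·c)`, cancelled).  RESULT (`secondVar_oneShot_nestedStepLaw_jets_graded`): p308750's three-term law + Faddeev–Popov terms, for the STRIPPED tables, with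
(i) GRADED namings and letters — every word acquires the sign `(−1)^{#transposed odd objects}`: `h𝔎₁ : H₁ + (−Q₁₁ᵀG₀Q₁₀ + Q₁₀ᵀG₁Q₁₀ + Q₁₀ᵀG₀Q₁₁) = 𝔎₁`,
`a1 : 𝔎₁W₀ + 𝔎₀W₁ = −𝔔₁ᵀY₀ + 𝔔₀ᵀY₁`, `a2 : … = 𝔔₂ᵀY₀ − 2•𝔔₁ᵀY₁ + 𝔔₀ᵀY₂`, NO `a*t`; (ii) the odd bordered jets (−)-PLACED
(`fromBlocks K₁ (−C₁ᵀ) C₁ 0`); (iii) the coarse jets' words with `Bᵀ ↦ −Bᵀ`.  Nothing of the dictionary asserted; [folklore] throughout.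

HONEST DEPENDENCY (page 1, mandatory): continuum YM on T⁴ ⇐ BetaPertH ∧ nine spine estimates (0/9 proved); BetaPertH ⇐ (D1) ∧ (D4) ∧ CAP+tail;
G-an2-4 gates asym, D1 and NE2/3/4.  HONEST FRAMING (cell contract, verbatim): «discharging `BetaPertH` makes Bałaban's UV stability UNCONDITIONAL —
a real constructive-QFT result; it is NOT the continuum limit and NOT the Clay problem.»  ABSOLUTE RULE (cell charter, verbatim): «No internally-minted
statement may enter as a cited fact. Every hypothesis is either kernel-proved in this package or a verbatim quotation of a PUBLISHED theorem with page
reference. The manuscript(s) under audit are NOT citable for their own disputed steps — they are the thing under adjudication; programme-internal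
(2001/route/tribunal) claims are never citable.»  No `def`, no `def … : Prop`, nothing cited, 0 sorry; 0 estimates; 0∕4 row-D1 binders; NOT (T-ID),
NOT SDF, NOT D1, NOT BetaPertH, NOT continuum, NOT Clay.  Road «FP» OWNER, b2b-balaban-beta-d1-p3 gen 18, 2026-08-22.  No existing file touched.
-/

noncomputable section

namespace Summit.QuantumFields.BalabanUV.Beta.FP.NestedStepLawOneShotJetsGraded

open Matrix
open scoped Kronecker
open Literature.MathematicalPhysics.QuantumFieldTheory.Balaban1983to89.Beta.Composition (kkt)
open Literature.MathematicalPhysics.QuantumFieldTheory.Balaban1983to89.Beta.CompositionSingular (effForm flucCov minOp minOpL)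
open Summit.QuantumFields.BalabanUV.Beta.D1BFx.LogDetSecondVariation (secondVar)
open Summit.QuantumFields.BalabanUV.Beta.D1BFx.ColourLift (e₂ e₃ e₂_symm_inl e₂_symm_inr e₃_symm_inl e₃_symm_inr_inl e₃_symm_inr_inr
  kkt_kronecker_symm kronecker_transpose' neg_kronecker kronecker_neg det_kkt_lift_ne_zero det_one_kronecker_ne_zero)
open Summit.QuantumFields.BalabanUV.Beta.FP.ColourDoubling (secondVar_kronecker_lift)
open Summit.QuantumFields.BalabanUV.Beta.FP.ColourDoublingKkt (secondVar_reindex secondVar_kkt_lift_strip secondVar_kkt_lift_strip_zeroSlice)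
open Summit.QuantumFields.BalabanUV.Beta.FP.NestedStepLawOneShotJets (secondVar_oneShot_nestedStepLaw_jets)
open Summit.QuantumFields.BalabanUV.Beta.FP.ColourDoublingBlocks (submatrix_id_mul mul_submatrix_id toBlocks₁₁_lift kkt_one_lift_inv flucCov_lift
  minOp_lift minOpL_lift effForm_lift fromRows_lift fromRows_lift_zero neg_kronecker_comm add_lift sub_lift neg_lift smul_lift kron_sub kron_add kron_neg
  kron_smul secondVar_submatrix_equiv kkt_fromRows_submatrix)

/-! ## §2 The graded one-shot-sliced composite step law -/

section Graded

variable {l ν μ κ ρ₁ ρ₂ : Type*} [Fintype l] [Fintype ν] [Fintype μ] [Fintype κ] [Fintype ρ₁] [Fintype ρ₂]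
  [DecidableEq l] [DecidableEq ν] [DecidableEq μ] [DecidableEq κ] [DecidableEq ρ₁] [DecidableEq ρ₂]

set_option linter.unusedSimpArgs false in
set_option maxHeartbeats 1600000 in
/-- [folklore] **THE ONE-SHOT-SLICED COMPOSITE STEP LAW FOR GRADED 2-JETS** (p308750 through the antisymmetric colour lift `c`, `cᵀ = −c`,
`tr(c·c) ≠ 0`, and stripped back).  Data as in `secondVar_oneShot_nestedStepLaw_jets`; the namings `h𝔎ₙ` and the ONE-SIDED Ward letters
`a0 a1 a2` in their GRADED shapes (sign `(−1)^(number of transposed odd objects)` on each word; odd objects: `H₁ G₁ Q₁₁ Q₂₁ W₁ Y₁ 𝔎₁ 𝔔₁`), the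
parities `𝔎₀ᵀ = 𝔎₀`, `𝔎₁ᵀ = −𝔎₁`, `𝔎₂ᵀ = 𝔎₂` in place of the two-sided letters, `b0 b1 b2`, the two Faddeev–Popov non-degeneracies and (INV)
unchanged.  CONCLUSION: the three-term law with the odd bordered jets (−)-PLACED and the coarse jets' words graded (`Bᵀ ↦ −Bᵀ`). -/
theorem secondVar_oneShot_nestedStepLaw_jets_graded
    (c : Matrix l l ℝ) (hc : cᵀ = -c) (htr : (c * c).trace ≠ 0)
    (H₀ H₁ H₂ : Matrix ν ν ℝ) (Q₁₀ Q₁₁ Q₁₂ : Matrix μ ν ℝ) (Q₂₀ Q₂₁ Q₂₂ : Matrix κ μ ℝ) (G₀ G₁ G₂ : Matrix μ μ ℝ)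
    (τ₁ : Matrix ρ₁ ν ℝ) (τ₂ : Matrix ρ₂ μ ℝ) (P : Matrix (ρ₂ ⊕ ρ₁) ν ℝ) (W₀ W₁ W₂ : Matrix ν (ρ₂ ⊕ ρ₁) ℝ) (Y₀ Y₁ Y₂ : Matrix κ (ρ₂ ⊕ ρ₁) ℝ)
    {𝔎₀ 𝔎₁ 𝔎₂ : Matrix ν ν ℝ} {𝔔₀ 𝔔₁ 𝔔₂ : Matrix κ ν ℝ}
    -- GRADED namings of the composite jets
    (h𝔎₀ : H₀ + Q₁₀ᵀ * G₀ * Q₁₀ = 𝔎₀) (h𝔎₁ : H₁ + (-(Q₁₁ᵀ * G₀ * Q₁₀) + Q₁₀ᵀ * G₁ * Q₁₀ + Q₁₀ᵀ * G₀ * Q₁₁) = 𝔎₁)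
    (h𝔎₂ : H₂ + ((Q₁₂ᵀ * G₀ * Q₁₀ + -(Q₁₁ᵀ * G₁ * Q₁₀) + -(Q₁₁ᵀ * G₀ * Q₁₁)) + (-(Q₁₁ᵀ * G₁ * Q₁₀) + Q₁₀ᵀ * G₂ * Q₁₀ + Q₁₀ᵀ * G₁ * Q₁₁)
            + (-(Q₁₁ᵀ * G₀ * Q₁₁) + Q₁₀ᵀ * G₁ * Q₁₁ + Q₁₀ᵀ * G₀ * Q₁₂)) = 𝔎₂)
    (h𝔔₀ : Q₂₀ * Q₁₀ = 𝔔₀) (h𝔔₁ : Q₂₁ * Q₁₀ + Q₂₀ * Q₁₁ = 𝔔₁) (h𝔔₂ : Q₂₂ * Q₁₀ + Q₂₁ * Q₁₁ + (Q₂₁ * Q₁₁ + Q₂₀ * Q₁₂) = 𝔔₂)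
    -- parities of the composite form jets (the two-sided letters follow)
    (h𝔎₀t : 𝔎₀ᵀ = 𝔎₀) (h𝔎₁t : 𝔎₁ᵀ = -𝔎₁) (h𝔎₂t : 𝔎₂ᵀ = 𝔎₂)
    -- GRADED one-sided Ward letters of the composite system
    (a0 : 𝔎₀ * W₀ = 𝔔₀ᵀ * Y₀) (a1 : 𝔎₁ * W₀ + 𝔎₀ * W₁ = -(𝔔₁ᵀ * Y₀) + 𝔔₀ᵀ * Y₁)
    (a2 : 𝔎₂ * W₀ + (2 : ℝ) • (𝔎₁ * W₁) + 𝔎₀ * W₂ = 𝔔₂ᵀ * Y₀ + -((2 : ℝ) • (𝔔₁ᵀ * Y₁)) + 𝔔₀ᵀ * Y₂)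
    (b0 : 𝔔₀ * W₀ = 0) (b1 : 𝔔₁ * W₀ + 𝔔₀ * W₁ = 0) (b2 : 𝔔₂ * W₀ + (2 : ℝ) • (𝔔₁ * W₁) + 𝔔₀ * W₂ = 0)
    (hPW : (P * W₀).det ≠ 0) (hTW : (fromRows (τ₂ * Q₁₀) τ₁ * W₀).det ≠ 0)
    {Γ : Matrix ν ν ℝ} {I : Matrix ν (μ ⊕ ρ₁) ℝ} {L : Matrix (μ ⊕ ρ₁) ν ℝ} {S : Matrix (μ ⊕ ρ₁) (μ ⊕ ρ₁) ℝ} {B : Matrix (μ ⊕ ρ₁) ν ℝ}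
    (hΓ : flucCov H₀ (fromRows Q₁₀ τ₁) = Γ) (hI : minOp H₀ (fromRows Q₁₀ τ₁) = I) (hL : minOpL H₀ (fromRows Q₁₀ τ₁) = L) (hS : effForm H₀ (fromRows Q₁₀ τ₁) = S)
    (hB : fromRows Q₁₁ (0 : Matrix ρ₁ ν ℝ) = B)
    (h1 : (kkt H₀ (fromRows Q₁₀ τ₁)).det ≠ 0)
    (h2 : (kkt (S.toBlocks₁₁ + G₀) (fromRows Q₂₀ τ₂)).det ≠ 0) :
    secondVar (kkt 𝔎₀ (fromRows 𝔔₀ P))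
        (fromBlocks 𝔎₁ (-(fromRows 𝔔₁ (0 : Matrix (ρ₂ ⊕ ρ₁) ν ℝ))ᵀ) (fromRows 𝔔₁ (0 : Matrix (ρ₂ ⊕ ρ₁) ν ℝ)) 0)
        (kkt 𝔎₂ (fromRows 𝔔₂ (0 : Matrix (ρ₂ ⊕ ρ₁) ν ℝ)))
      = secondVar (kkt H₀ (fromRows Q₁₀ τ₁)) (fromBlocks H₁ (-Bᵀ) B 0) (kkt H₂ (fromRows Q₁₂ (0 : Matrix ρ₁ ν ℝ)))
        + secondVar
            (kkt (S.toBlocks₁₁ + G₀) (fromRows Q₂₀ τ₂))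
            (fromBlocks (((L * H₁ - S * B) * I + L * Bᵀ * S).toBlocks₁₁ + G₁) (-(fromRows Q₂₁ (0 : Matrix ρ₂ μ ℝ))ᵀ)
              (fromRows Q₂₁ (0 : Matrix ρ₂ μ ℝ)) 0)
            (kkt ((((-((L * H₁ - S * B) * Γ - L * Bᵀ * L) * H₁ + L * H₂
                      - (((L * H₁ - S * B) * I + L * Bᵀ * S) * B + S * fromRows Q₁₂ (0 : Matrix ρ₁ ν ℝ))) * I
                    + (L * H₁ - S * B) * (-((Γ * H₁ + I * B) * I + Γ * Bᵀ * S)))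
                  - ((-((L * H₁ - S * B) * Γ - L * Bᵀ * L) * (-Bᵀ) + L * (fromRows Q₁₂ (0 : Matrix ρ₁ ν ℝ))ᵀ) * S
                      + L * (-Bᵀ) * ((L * H₁ - S * B) * I + L * Bᵀ * S))).toBlocks₁₁ + G₂)
              (fromRows Q₂₂ (0 : Matrix ρ₂ μ ℝ)))
        + (2 * secondVar (P * W₀) (P * W₁) (P * W₂)
          - 2 * secondVar (fromRows (τ₂ * Q₁₀) τ₁ * W₀) (fromRows (τ₂ * Q₁₁) (0 : Matrix ρ₁ ν ℝ) * W₀ + fromRows (τ₂ * Q₁₀) τ₁ * W₁)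
              (fromRows (τ₂ * Q₁₂) (0 : Matrix ρ₁ ν ℝ) * W₀ + fromRows (τ₂ * Q₁₁) (0 : Matrix ρ₁ ν ℝ) * W₁
                + (fromRows (τ₂ * Q₁₁) (0 : Matrix ρ₁ ν ℝ) * W₁ + fromRows (τ₂ * Q₁₀) τ₁ * W₂))) := by
  subst hB
  -- (1) every LIFTED hypothesis of p308750 from its graded stripped twin
  have h𝔎₀' : ((1 : Matrix l l ℝ) ⊗ₖ H₀) + ((1 : Matrix l l ℝ) ⊗ₖ Q₁₀)ᵀ * ((1 : Matrix l l ℝ) ⊗ₖ G₀) * ((1 : Matrix l l ℝ) ⊗ₖ Q₁₀) = ((1 : Matrix l l ℝ) ⊗ₖ 𝔎₀) := by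
    have h := h𝔎₀; simp only [Matrix.transpose_submatrix, kronecker_transpose', hc, Matrix.transpose_one, Matrix.transpose_mul, Matrix.transpose_transpose,
      Matrix.sub_mul, Matrix.mul_sub, Matrix.add_mul, Matrix.mul_add, Matrix.neg_mul, Matrix.mul_neg, Matrix.smul_mul, Matrix.mul_smul,
      submatrix_id_mul, mul_submatrix_id, Matrix.submatrix_mul_equiv, Matrix.submatrix_submatrix, Function.comp_id, Function.id_comp,
      ← Matrix.mul_kronecker_mul, Matrix.one_mul, Matrix.mul_one, neg_mul, mul_neg, neg_neg, neg_kronecker_comm, add_lift, sub_lift, neg_lift,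
      smul_lift, kron_add, kron_sub, kron_neg, kron_smul, toBlocks₁₁_lift, sub_neg_eq_add, Matrix.mul_assoc, smul_neg, neg_add_rev,
      fromRows_lift, fromRows_lift_zero] at h ⊢; rw [h]
  have h𝔎₁' : (c ⊗ₖ H₁) + ((c ⊗ₖ Q₁₁)ᵀ * ((1 : Matrix l l ℝ) ⊗ₖ G₀) * ((1 : Matrix l l ℝ) ⊗ₖ Q₁₀) + ((1 : Matrix l l ℝ) ⊗ₖ Q₁₀)ᵀ * (c ⊗ₖ G₁) * ((1 : Matrix l l ℝ) ⊗ₖ Q₁₀)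
      + ((1 : Matrix l l ℝ) ⊗ₖ Q₁₀)ᵀ * ((1 : Matrix l l ℝ) ⊗ₖ G₀) * (c ⊗ₖ Q₁₁)) = (c ⊗ₖ 𝔎₁) := by
    have h := h𝔎₁; simp only [Matrix.transpose_submatrix, kronecker_transpose', hc, Matrix.transpose_one, Matrix.transpose_mul, Matrix.transpose_transpose,
      Matrix.sub_mul, Matrix.mul_sub, Matrix.add_mul, Matrix.mul_add, Matrix.neg_mul, Matrix.mul_neg, Matrix.smul_mul, Matrix.mul_smul,
      submatrix_id_mul, mul_submatrix_id, Matrix.submatrix_mul_equiv, Matrix.submatrix_submatrix, Function.comp_id, Function.id_comp,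
      ← Matrix.mul_kronecker_mul, Matrix.one_mul, Matrix.mul_one, neg_mul, mul_neg, neg_neg, neg_kronecker_comm, add_lift, sub_lift, neg_lift,
      smul_lift, kron_add, kron_sub, kron_neg, kron_smul, toBlocks₁₁_lift, sub_neg_eq_add, Matrix.mul_assoc, smul_neg, neg_add_rev,
      fromRows_lift, fromRows_lift_zero] at h ⊢; rw [h]
  have h𝔎₂' : ((c * c) ⊗ₖ H₂) + ((((c * c) ⊗ₖ Q₁₂)ᵀ * ((1 : Matrix l l ℝ) ⊗ₖ G₀) * ((1 : Matrix l l ℝ) ⊗ₖ Q₁₀) + (c ⊗ₖ Q₁₁)ᵀ * (c ⊗ₖ G₁) * ((1 : Matrix l l ℝ) ⊗ₖ Q₁₀)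
      + (c ⊗ₖ Q₁₁)ᵀ * ((1 : Matrix l l ℝ) ⊗ₖ G₀) * (c ⊗ₖ Q₁₁)) + ((c ⊗ₖ Q₁₁)ᵀ * (c ⊗ₖ G₁) * ((1 : Matrix l l ℝ) ⊗ₖ Q₁₀) + ((1 : Matrix l l ℝ) ⊗ₖ Q₁₀)ᵀ * ((c * c) ⊗ₖ G₂) * ((1 : Matrix l l ℝ) ⊗ₖ Q₁₀)
      + ((1 : Matrix l l ℝ) ⊗ₖ Q₁₀)ᵀ * (c ⊗ₖ G₁) * (c ⊗ₖ Q₁₁)) + ((c ⊗ₖ Q₁₁)ᵀ * ((1 : Matrix l l ℝ) ⊗ₖ G₀) * (c ⊗ₖ Q₁₁) + ((1 : Matrix l l ℝ) ⊗ₖ Q₁₀)ᵀ * (c ⊗ₖ G₁) * (c ⊗ₖ Q₁₁)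
      + ((1 : Matrix l l ℝ) ⊗ₖ Q₁₀)ᵀ * ((1 : Matrix l l ℝ) ⊗ₖ G₀) * ((c * c) ⊗ₖ Q₁₂))) = ((c * c) ⊗ₖ 𝔎₂) := by
    have h := h𝔎₂; simp only [Matrix.transpose_submatrix, kronecker_transpose', hc, Matrix.transpose_one, Matrix.transpose_mul, Matrix.transpose_transpose,
      Matrix.sub_mul, Matrix.mul_sub, Matrix.add_mul, Matrix.mul_add, Matrix.neg_mul, Matrix.mul_neg, Matrix.smul_mul, Matrix.mul_smul,
      submatrix_id_mul, mul_submatrix_id, Matrix.submatrix_mul_equiv, Matrix.submatrix_submatrix, Function.comp_id, Function.id_comp,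
      ← Matrix.mul_kronecker_mul, Matrix.one_mul, Matrix.mul_one, neg_mul, mul_neg, neg_neg, neg_kronecker_comm, add_lift, sub_lift, neg_lift,
      smul_lift, kron_add, kron_sub, kron_neg, kron_smul, toBlocks₁₁_lift, sub_neg_eq_add, Matrix.mul_assoc, smul_neg, neg_add_rev,
      fromRows_lift, fromRows_lift_zero] at h ⊢; rw [h]
  have h𝔔₀' : ((1 : Matrix l l ℝ) ⊗ₖ Q₂₀) * ((1 : Matrix l l ℝ) ⊗ₖ Q₁₀) = ((1 : Matrix l l ℝ) ⊗ₖ 𝔔₀) := by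
    have h := h𝔔₀; simp only [Matrix.transpose_submatrix, kronecker_transpose', hc, Matrix.transpose_one, Matrix.transpose_mul, Matrix.transpose_transpose,
      Matrix.sub_mul, Matrix.mul_sub, Matrix.add_mul, Matrix.mul_add, Matrix.neg_mul, Matrix.mul_neg, Matrix.smul_mul, Matrix.mul_smul,
      submatrix_id_mul, mul_submatrix_id, Matrix.submatrix_mul_equiv, Matrix.submatrix_submatrix, Function.comp_id, Function.id_comp,
      ← Matrix.mul_kronecker_mul, Matrix.one_mul, Matrix.mul_one, neg_mul, mul_neg, neg_neg, neg_kronecker_comm, add_lift, sub_lift, neg_lift,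
      smul_lift, kron_add, kron_sub, kron_neg, kron_smul, toBlocks₁₁_lift, sub_neg_eq_add, Matrix.mul_assoc, smul_neg, neg_add_rev,
      fromRows_lift, fromRows_lift_zero] at h ⊢; rw [h]
  have h𝔔₁' : (c ⊗ₖ Q₂₁) * ((1 : Matrix l l ℝ) ⊗ₖ Q₁₀) + ((1 : Matrix l l ℝ) ⊗ₖ Q₂₀) * (c ⊗ₖ Q₁₁) = (c ⊗ₖ 𝔔₁) := by
    have h := h𝔔₁; simp only [Matrix.transpose_submatrix, kronecker_transpose', hc, Matrix.transpose_one, Matrix.transpose_mul, Matrix.transpose_transpose,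
      Matrix.sub_mul, Matrix.mul_sub, Matrix.add_mul, Matrix.mul_add, Matrix.neg_mul, Matrix.mul_neg, Matrix.smul_mul, Matrix.mul_smul,
      submatrix_id_mul, mul_submatrix_id, Matrix.submatrix_mul_equiv, Matrix.submatrix_submatrix, Function.comp_id, Function.id_comp,
      ← Matrix.mul_kronecker_mul, Matrix.one_mul, Matrix.mul_one, neg_mul, mul_neg, neg_neg, neg_kronecker_comm, add_lift, sub_lift, neg_lift,
      smul_lift, kron_add, kron_sub, kron_neg, kron_smul, toBlocks₁₁_lift, sub_neg_eq_add, Matrix.mul_assoc, smul_neg, neg_add_rev,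
      fromRows_lift, fromRows_lift_zero] at h ⊢; rw [h]
  have h𝔔₂' : ((c * c) ⊗ₖ Q₂₂) * ((1 : Matrix l l ℝ) ⊗ₖ Q₁₀) + (c ⊗ₖ Q₂₁) * (c ⊗ₖ Q₁₁) + ((c ⊗ₖ Q₂₁) * (c ⊗ₖ Q₁₁) + ((1 : Matrix l l ℝ) ⊗ₖ Q₂₀) * ((c * c) ⊗ₖ Q₁₂))
      = ((c * c) ⊗ₖ 𝔔₂) := by
    have h := h𝔔₂; simp only [Matrix.transpose_submatrix, kronecker_transpose', hc, Matrix.transpose_one, Matrix.transpose_mul, Matrix.transpose_transpose,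
      Matrix.sub_mul, Matrix.mul_sub, Matrix.add_mul, Matrix.mul_add, Matrix.neg_mul, Matrix.mul_neg, Matrix.smul_mul, Matrix.mul_smul,
      submatrix_id_mul, mul_submatrix_id, Matrix.submatrix_mul_equiv, Matrix.submatrix_submatrix, Function.comp_id, Function.id_comp,
      ← Matrix.mul_kronecker_mul, Matrix.one_mul, Matrix.mul_one, neg_mul, mul_neg, neg_neg, neg_kronecker_comm, add_lift, sub_lift, neg_lift,
      smul_lift, kron_add, kron_sub, kron_neg, kron_smul, toBlocks₁₁_lift, sub_neg_eq_add, Matrix.mul_assoc, smul_neg, neg_add_rev,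
      fromRows_lift, fromRows_lift_zero] at h ⊢; rw [h]
  have a0' : ((1 : Matrix l l ℝ) ⊗ₖ 𝔎₀) * (((1 : Matrix l l ℝ) ⊗ₖ W₀).submatrix id (e₂ l ρ₂ ρ₁).symm) = ((1 : Matrix l l ℝ) ⊗ₖ 𝔔₀)ᵀ * (((1 : Matrix l l ℝ) ⊗ₖ Y₀).submatrix id (e₂ l ρ₂ ρ₁).symm) := by
    have h := a0; simp only [Matrix.transpose_submatrix, kronecker_transpose', hc, Matrix.transpose_one, Matrix.transpose_mul, Matrix.transpose_transpose,
      Matrix.sub_mul, Matrix.mul_sub, Matrix.add_mul, Matrix.mul_add, Matrix.neg_mul, Matrix.mul_neg, Matrix.smul_mul, Matrix.mul_smul,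
      submatrix_id_mul, mul_submatrix_id, Matrix.submatrix_mul_equiv, Matrix.submatrix_submatrix, Function.comp_id, Function.id_comp,
      ← Matrix.mul_kronecker_mul, Matrix.one_mul, Matrix.mul_one, neg_mul, mul_neg, neg_neg, neg_kronecker_comm, add_lift, sub_lift, neg_lift,
      smul_lift, kron_add, kron_sub, kron_neg, kron_smul, toBlocks₁₁_lift, sub_neg_eq_add, Matrix.mul_assoc, smul_neg, neg_add_rev,
      fromRows_lift, fromRows_lift_zero] at h ⊢; rw [h]
  have a1' : (c ⊗ₖ 𝔎₁) * (((1 : Matrix l l ℝ) ⊗ₖ W₀).submatrix id (e₂ l ρ₂ ρ₁).symm) + ((1 : Matrix l l ℝ) ⊗ₖ 𝔎₀) * ((c ⊗ₖ W₁).submatrix id (e₂ l ρ₂ ρ₁).symm) = (c ⊗ₖ 𝔔₁)ᵀ * (((1 : Matrix l l ℝ) ⊗ₖ Y₀).submatrix id (e₂ l ρ₂ ρ₁).symm) + ((1 : Matrix l l ℝ) ⊗ₖ 𝔔₀)ᵀ * ((c ⊗ₖ Y₁).submatrix id (e₂ l ρ₂ ρ₁).symm) := by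
    have h := a1; simp only [Matrix.transpose_submatrix, kronecker_transpose', hc, Matrix.transpose_one, Matrix.transpose_mul, Matrix.transpose_transpose,
      Matrix.sub_mul, Matrix.mul_sub, Matrix.add_mul, Matrix.mul_add, Matrix.neg_mul, Matrix.mul_neg, Matrix.smul_mul, Matrix.mul_smul,
      submatrix_id_mul, mul_submatrix_id, Matrix.submatrix_mul_equiv, Matrix.submatrix_submatrix, Function.comp_id, Function.id_comp,
      ← Matrix.mul_kronecker_mul, Matrix.one_mul, Matrix.mul_one, neg_mul, mul_neg, neg_neg, neg_kronecker_comm, add_lift, sub_lift, neg_lift,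
      smul_lift, kron_add, kron_sub, kron_neg, kron_smul, toBlocks₁₁_lift, sub_neg_eq_add, Matrix.mul_assoc, smul_neg, neg_add_rev,
      fromRows_lift, fromRows_lift_zero] at h ⊢; rw [h]
  have a2' : ((c * c) ⊗ₖ 𝔎₂) * (((1 : Matrix l l ℝ) ⊗ₖ W₀).submatrix id (e₂ l ρ₂ ρ₁).symm) + (2 : ℝ) • ((c ⊗ₖ 𝔎₁) * ((c ⊗ₖ W₁).submatrix id (e₂ l ρ₂ ρ₁).symm)) + ((1 : Matrix l l ℝ) ⊗ₖ 𝔎₀) * (((c * c) ⊗ₖ W₂).submatrix id (e₂ l ρ₂ ρ₁).symm)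
      = ((c * c) ⊗ₖ 𝔔₂)ᵀ * (((1 : Matrix l l ℝ) ⊗ₖ Y₀).submatrix id (e₂ l ρ₂ ρ₁).symm) + (2 : ℝ) • ((c ⊗ₖ 𝔔₁)ᵀ * ((c ⊗ₖ Y₁).submatrix id (e₂ l ρ₂ ρ₁).symm)) + ((1 : Matrix l l ℝ) ⊗ₖ 𝔔₀)ᵀ * (((c * c) ⊗ₖ Y₂).submatrix id (e₂ l ρ₂ ρ₁).symm) := by
    have h := a2; simp only [Matrix.transpose_submatrix, kronecker_transpose', hc, Matrix.transpose_one, Matrix.transpose_mul, Matrix.transpose_transpose,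
      Matrix.sub_mul, Matrix.mul_sub, Matrix.add_mul, Matrix.mul_add, Matrix.neg_mul, Matrix.mul_neg, Matrix.smul_mul, Matrix.mul_smul,
      submatrix_id_mul, mul_submatrix_id, Matrix.submatrix_mul_equiv, Matrix.submatrix_submatrix, Function.comp_id, Function.id_comp,
      ← Matrix.mul_kronecker_mul, Matrix.one_mul, Matrix.mul_one, neg_mul, mul_neg, neg_neg, neg_kronecker_comm, add_lift, sub_lift, neg_lift,
      smul_lift, kron_add, kron_sub, kron_neg, kron_smul, toBlocks₁₁_lift, sub_neg_eq_add, Matrix.mul_assoc, smul_neg, neg_add_rev,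
      fromRows_lift, fromRows_lift_zero] at h ⊢; rw [h]
  have a0t' : ((1 : Matrix l l ℝ) ⊗ₖ 𝔎₀)ᵀ * (((1 : Matrix l l ℝ) ⊗ₖ W₀).submatrix id (e₂ l ρ₂ ρ₁).symm) = ((1 : Matrix l l ℝ) ⊗ₖ 𝔔₀)ᵀ * (((1 : Matrix l l ℝ) ⊗ₖ Y₀).submatrix id (e₂ l ρ₂ ρ₁).symm) := by
    have h := a0; simp only [Matrix.transpose_submatrix, kronecker_transpose', hc, Matrix.transpose_one, Matrix.transpose_mul, Matrix.transpose_transpose,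
      Matrix.sub_mul, Matrix.mul_sub, Matrix.add_mul, Matrix.mul_add, Matrix.neg_mul, Matrix.mul_neg, Matrix.smul_mul, Matrix.mul_smul,
      submatrix_id_mul, mul_submatrix_id, Matrix.submatrix_mul_equiv, Matrix.submatrix_submatrix, Function.comp_id, Function.id_comp,
      ← Matrix.mul_kronecker_mul, Matrix.one_mul, Matrix.mul_one, neg_mul, mul_neg, neg_neg, neg_kronecker_comm, add_lift, sub_lift, neg_lift,
      smul_lift, kron_add, kron_sub, kron_neg, kron_smul, toBlocks₁₁_lift, sub_neg_eq_add, Matrix.mul_assoc, smul_neg, neg_add_rev,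
      fromRows_lift, fromRows_lift_zero, h𝔎₀t] at h ⊢; rw [h]
  have a1t' : (c ⊗ₖ 𝔎₁)ᵀ * (((1 : Matrix l l ℝ) ⊗ₖ W₀).submatrix id (e₂ l ρ₂ ρ₁).symm) + ((1 : Matrix l l ℝ) ⊗ₖ 𝔎₀)ᵀ * ((c ⊗ₖ W₁).submatrix id (e₂ l ρ₂ ρ₁).symm) = (c ⊗ₖ 𝔔₁)ᵀ * (((1 : Matrix l l ℝ) ⊗ₖ Y₀).submatrix id (e₂ l ρ₂ ρ₁).symm) + ((1 : Matrix l l ℝ) ⊗ₖ 𝔔₀)ᵀ * ((c ⊗ₖ Y₁).submatrix id (e₂ l ρ₂ ρ₁).symm) := by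
    have h := a1; simp only [Matrix.transpose_submatrix, kronecker_transpose', hc, Matrix.transpose_one, Matrix.transpose_mul, Matrix.transpose_transpose,
      Matrix.sub_mul, Matrix.mul_sub, Matrix.add_mul, Matrix.mul_add, Matrix.neg_mul, Matrix.mul_neg, Matrix.smul_mul, Matrix.mul_smul,
      submatrix_id_mul, mul_submatrix_id, Matrix.submatrix_mul_equiv, Matrix.submatrix_submatrix, Function.comp_id, Function.id_comp,
      ← Matrix.mul_kronecker_mul, Matrix.one_mul, Matrix.mul_one, neg_mul, mul_neg, neg_neg, neg_kronecker_comm, add_lift, sub_lift, neg_lift,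
      smul_lift, kron_add, kron_sub, kron_neg, kron_smul, toBlocks₁₁_lift, sub_neg_eq_add, Matrix.mul_assoc, smul_neg, neg_add_rev,
      fromRows_lift, fromRows_lift_zero, h𝔎₀t, h𝔎₁t] at h ⊢; rw [h]
  have a2t' : ((c * c) ⊗ₖ 𝔎₂)ᵀ * (((1 : Matrix l l ℝ) ⊗ₖ W₀).submatrix id (e₂ l ρ₂ ρ₁).symm) + (2 : ℝ) • ((c ⊗ₖ 𝔎₁)ᵀ * ((c ⊗ₖ W₁).submatrix id (e₂ l ρ₂ ρ₁).symm)) + ((1 : Matrix l l ℝ) ⊗ₖ 𝔎₀)ᵀ * (((c * c) ⊗ₖ W₂).submatrix id (e₂ l ρ₂ ρ₁).symm)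
      = ((c * c) ⊗ₖ 𝔔₂)ᵀ * (((1 : Matrix l l ℝ) ⊗ₖ Y₀).submatrix id (e₂ l ρ₂ ρ₁).symm) + (2 : ℝ) • ((c ⊗ₖ 𝔔₁)ᵀ * ((c ⊗ₖ Y₁).submatrix id (e₂ l ρ₂ ρ₁).symm)) + ((1 : Matrix l l ℝ) ⊗ₖ 𝔔₀)ᵀ * (((c * c) ⊗ₖ Y₂).submatrix id (e₂ l ρ₂ ρ₁).symm) := by
    have h := a2; simp only [Matrix.transpose_submatrix, kronecker_transpose', hc, Matrix.transpose_one, Matrix.transpose_mul, Matrix.transpose_transpose,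
      Matrix.sub_mul, Matrix.mul_sub, Matrix.add_mul, Matrix.mul_add, Matrix.neg_mul, Matrix.mul_neg, Matrix.smul_mul, Matrix.mul_smul,
      submatrix_id_mul, mul_submatrix_id, Matrix.submatrix_mul_equiv, Matrix.submatrix_submatrix, Function.comp_id, Function.id_comp,
      ← Matrix.mul_kronecker_mul, Matrix.one_mul, Matrix.mul_one, neg_mul, mul_neg, neg_neg, neg_kronecker_comm, add_lift, sub_lift, neg_lift,
      smul_lift, kron_add, kron_sub, kron_neg, kron_smul, toBlocks₁₁_lift, sub_neg_eq_add, Matrix.mul_assoc, smul_neg, neg_add_rev,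
      fromRows_lift, fromRows_lift_zero, h𝔎₀t, h𝔎₁t, h𝔎₂t] at h ⊢; rw [h]
  have b0' : ((1 : Matrix l l ℝ) ⊗ₖ 𝔔₀) * (((1 : Matrix l l ℝ) ⊗ₖ W₀).submatrix id (e₂ l ρ₂ ρ₁).symm) = 0 := by
    have h := b0; simp only [Matrix.transpose_submatrix, kronecker_transpose', hc, Matrix.transpose_one, Matrix.transpose_mul, Matrix.transpose_transpose,
      Matrix.sub_mul, Matrix.mul_sub, Matrix.add_mul, Matrix.mul_add, Matrix.neg_mul, Matrix.mul_neg, Matrix.smul_mul, Matrix.mul_smul,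
      submatrix_id_mul, mul_submatrix_id, Matrix.submatrix_mul_equiv, Matrix.submatrix_submatrix, Function.comp_id, Function.id_comp,
      ← Matrix.mul_kronecker_mul, Matrix.one_mul, Matrix.mul_one, neg_mul, mul_neg, neg_neg, neg_kronecker_comm, add_lift, sub_lift, neg_lift,
      smul_lift, kron_add, kron_sub, kron_neg, kron_smul, toBlocks₁₁_lift, sub_neg_eq_add, Matrix.mul_assoc, smul_neg, neg_add_rev,
      fromRows_lift, fromRows_lift_zero] at h ⊢; rw [h, Matrix.kronecker_zero, Matrix.submatrix_zero]; rfl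
  have b1' : (c ⊗ₖ 𝔔₁) * (((1 : Matrix l l ℝ) ⊗ₖ W₀).submatrix id (e₂ l ρ₂ ρ₁).symm) + ((1 : Matrix l l ℝ) ⊗ₖ 𝔔₀) * ((c ⊗ₖ W₁).submatrix id (e₂ l ρ₂ ρ₁).symm) = 0 := by
    have h := b1; simp only [Matrix.transpose_submatrix, kronecker_transpose', hc, Matrix.transpose_one, Matrix.transpose_mul, Matrix.transpose_transpose,
      Matrix.sub_mul, Matrix.mul_sub, Matrix.add_mul, Matrix.mul_add, Matrix.neg_mul, Matrix.mul_neg, Matrix.smul_mul, Matrix.mul_smul,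
      submatrix_id_mul, mul_submatrix_id, Matrix.submatrix_mul_equiv, Matrix.submatrix_submatrix, Function.comp_id, Function.id_comp,
      ← Matrix.mul_kronecker_mul, Matrix.one_mul, Matrix.mul_one, neg_mul, mul_neg, neg_neg, neg_kronecker_comm, add_lift, sub_lift, neg_lift,
      smul_lift, kron_add, kron_sub, kron_neg, kron_smul, toBlocks₁₁_lift, sub_neg_eq_add, Matrix.mul_assoc, smul_neg, neg_add_rev,
      fromRows_lift, fromRows_lift_zero] at h ⊢; rw [h, Matrix.kronecker_zero, Matrix.submatrix_zero]; rfl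
  have b2' : ((c * c) ⊗ₖ 𝔔₂) * (((1 : Matrix l l ℝ) ⊗ₖ W₀).submatrix id (e₂ l ρ₂ ρ₁).symm) + (2 : ℝ) • ((c ⊗ₖ 𝔔₁) * ((c ⊗ₖ W₁).submatrix id (e₂ l ρ₂ ρ₁).symm)) + ((1 : Matrix l l ℝ) ⊗ₖ 𝔔₀) * (((c * c) ⊗ₖ W₂).submatrix id (e₂ l ρ₂ ρ₁).symm) = 0 := by
    have h := b2; simp only [Matrix.transpose_submatrix, kronecker_transpose', hc, Matrix.transpose_one, Matrix.transpose_mul, Matrix.transpose_transpose,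
      Matrix.sub_mul, Matrix.mul_sub, Matrix.add_mul, Matrix.mul_add, Matrix.neg_mul, Matrix.mul_neg, Matrix.smul_mul, Matrix.mul_smul,
      submatrix_id_mul, mul_submatrix_id, Matrix.submatrix_mul_equiv, Matrix.submatrix_submatrix, Function.comp_id, Function.id_comp,
      ← Matrix.mul_kronecker_mul, Matrix.one_mul, Matrix.mul_one, neg_mul, mul_neg, neg_neg, neg_kronecker_comm, add_lift, sub_lift, neg_lift,
      smul_lift, kron_add, kron_sub, kron_neg, kron_smul, toBlocks₁₁_lift, sub_neg_eq_add, Matrix.mul_assoc, smul_neg, neg_add_rev,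
      fromRows_lift, fromRows_lift_zero] at h ⊢; rw [h, Matrix.kronecker_zero, Matrix.submatrix_zero]; rfl
  have hPW' : ((((1 : Matrix l l ℝ) ⊗ₖ P).submatrix (e₂ l ρ₂ ρ₁).symm id) * (((1 : Matrix l l ℝ) ⊗ₖ W₀).submatrix id (e₂ l ρ₂ ρ₁).symm)).det ≠ 0 := by
    simp only [Matrix.transpose_submatrix, kronecker_transpose', hc, Matrix.transpose_one, Matrix.transpose_mul, Matrix.transpose_transpose,
      Matrix.sub_mul, Matrix.mul_sub, Matrix.add_mul, Matrix.mul_add, Matrix.neg_mul, Matrix.mul_neg, Matrix.smul_mul, Matrix.mul_smul,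
      submatrix_id_mul, mul_submatrix_id, Matrix.submatrix_mul_equiv, Matrix.submatrix_submatrix, Function.comp_id, Function.id_comp,
      ← Matrix.mul_kronecker_mul, Matrix.one_mul, Matrix.mul_one, neg_mul, mul_neg, neg_neg, neg_kronecker_comm, add_lift, sub_lift, neg_lift,
      smul_lift, kron_add, kron_sub, kron_neg, kron_smul, toBlocks₁₁_lift, sub_neg_eq_add, Matrix.mul_assoc, smul_neg, neg_add_rev,
      fromRows_lift, fromRows_lift_zero]
    rw [Matrix.det_submatrix_equiv_self]; exact det_one_kronecker_ne_zero hPW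
  have hTW' : (fromRows (((1 : Matrix l l ℝ) ⊗ₖ τ₂) * ((1 : Matrix l l ℝ) ⊗ₖ Q₁₀)) ((1 : Matrix l l ℝ) ⊗ₖ τ₁) * (((1 : Matrix l l ℝ) ⊗ₖ W₀).submatrix id (e₂ l ρ₂ ρ₁).symm)).det ≠ 0 := by
    simp only [Matrix.transpose_submatrix, kronecker_transpose', hc, Matrix.transpose_one, Matrix.transpose_mul, Matrix.transpose_transpose,
      Matrix.sub_mul, Matrix.mul_sub, Matrix.add_mul, Matrix.mul_add, Matrix.neg_mul, Matrix.mul_neg, Matrix.smul_mul, Matrix.mul_smul,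
      submatrix_id_mul, mul_submatrix_id, Matrix.submatrix_mul_equiv, Matrix.submatrix_submatrix, Function.comp_id, Function.id_comp,
      ← Matrix.mul_kronecker_mul, Matrix.one_mul, Matrix.mul_one, neg_mul, mul_neg, neg_neg, neg_kronecker_comm, add_lift, sub_lift, neg_lift,
      smul_lift, kron_add, kron_sub, kron_neg, kron_smul, toBlocks₁₁_lift, sub_neg_eq_add, Matrix.mul_assoc, smul_neg, neg_add_rev,
      fromRows_lift, fromRows_lift_zero]
    rw [Matrix.det_submatrix_equiv_self]; exact det_one_kronecker_ne_zero hTW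
  have hΓ' : flucCov ((1 : Matrix l l ℝ) ⊗ₖ H₀) (fromRows ((1 : Matrix l l ℝ) ⊗ₖ Q₁₀) ((1 : Matrix l l ℝ) ⊗ₖ τ₁)) = ((1 : Matrix l l ℝ) ⊗ₖ Γ) := by rw [flucCov_lift, hΓ]
  have hI' : minOp ((1 : Matrix l l ℝ) ⊗ₖ H₀) (fromRows ((1 : Matrix l l ℝ) ⊗ₖ Q₁₀) ((1 : Matrix l l ℝ) ⊗ₖ τ₁)) = (((1 : Matrix l l ℝ) ⊗ₖ I)).submatrix id (e₂ l μ ρ₁).symm := by rw [minOp_lift, hI]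
  have hL' : minOpL ((1 : Matrix l l ℝ) ⊗ₖ H₀) (fromRows ((1 : Matrix l l ℝ) ⊗ₖ Q₁₀) ((1 : Matrix l l ℝ) ⊗ₖ τ₁)) = (((1 : Matrix l l ℝ) ⊗ₖ L)).submatrix (e₂ l μ ρ₁).symm id := by rw [minOpL_lift, hL]
  have hS' : effForm ((1 : Matrix l l ℝ) ⊗ₖ H₀) (fromRows ((1 : Matrix l l ℝ) ⊗ₖ Q₁₀) ((1 : Matrix l l ℝ) ⊗ₖ τ₁)) = (((1 : Matrix l l ℝ) ⊗ₖ S)).submatrix (e₂ l μ ρ₁).symm (e₂ l μ ρ₁).symm := by rw [effForm_lift, hS]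
  have hB' : fromRows (c ⊗ₖ Q₁₁) (0 : Matrix (l × ρ₁) (l × ν) ℝ) = fromRows (c ⊗ₖ Q₁₁) (0 : Matrix (l × ρ₁) (l × ν) ℝ) := rfl
  have h1' : (kkt ((1 : Matrix l l ℝ) ⊗ₖ H₀) (fromRows ((1 : Matrix l l ℝ) ⊗ₖ Q₁₀) ((1 : Matrix l l ℝ) ⊗ₖ τ₁))).det ≠ 0 := det_kkt_lift_ne_zero h1
  have h2' : (kkt (((((1 : Matrix l l ℝ) ⊗ₖ S)).submatrix (e₂ l μ ρ₁).symm (e₂ l μ ρ₁).symm).toBlocks₁₁ + ((1 : Matrix l l ℝ) ⊗ₖ G₀)) (fromRows ((1 : Matrix l l ℝ) ⊗ₖ Q₂₀) ((1 : Matrix l l ℝ) ⊗ₖ τ₂))).det ≠ 0 := by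
    rw [toBlocks₁₁_lift, kron_add]; exact det_kkt_lift_ne_zero h2
  -- (2) p308750 at the lifted objects
  have main := secondVar_oneShot_nestedStepLaw_jets ((1 : Matrix l l ℝ) ⊗ₖ H₀) (c ⊗ₖ H₁) ((c * c) ⊗ₖ H₂) ((1 : Matrix l l ℝ) ⊗ₖ Q₁₀) (c ⊗ₖ Q₁₁) ((c * c) ⊗ₖ Q₁₂)
    ((1 : Matrix l l ℝ) ⊗ₖ Q₂₀) (c ⊗ₖ Q₂₁) ((c * c) ⊗ₖ Q₂₂) ((1 : Matrix l l ℝ) ⊗ₖ G₀) (c ⊗ₖ G₁) ((c * c) ⊗ₖ G₂) ((1 : Matrix l l ℝ) ⊗ₖ τ₁) ((1 : Matrix l l ℝ) ⊗ₖ τ₂) (((1 : Matrix l l ℝ) ⊗ₖ P).submatrix (e₂ l ρ₂ ρ₁).symm id) (((1 : Matrix l l ℝ) ⊗ₖ W₀).submatrix id (e₂ l ρ₂ ρ₁).symm) ((c ⊗ₖ W₁).submatrix id (e₂ l ρ₂ ρ₁).symm) (((c * c) ⊗ₖ W₂).submatrix id (e₂ l ρ₂ ρ₁).symm)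
    (((1 : Matrix l l ℝ) ⊗ₖ Y₀).submatrix id (e₂ l ρ₂ ρ₁).symm) ((c ⊗ₖ Y₁).submatrix id (e₂ l ρ₂ ρ₁).symm) (((c * c) ⊗ₖ Y₂).submatrix id (e₂ l ρ₂ ρ₁).symm) (((1 : Matrix l l ℝ) ⊗ₖ Y₀).submatrix id (e₂ l ρ₂ ρ₁).symm) ((c ⊗ₖ Y₁).submatrix id (e₂ l ρ₂ ρ₁).symm) (((c * c) ⊗ₖ Y₂).submatrix id (e₂ l ρ₂ ρ₁).symm) h𝔎₀' h𝔎₁' h𝔎₂' h𝔔₀' h𝔔₁' h𝔔₂' a0' a1' a2' a0t' a1t' a2t' b0' b1' b2' hPW' hTW'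
    hΓ' hI' hL' hS' hB' h1' h2'
  -- (3) strip back: the coarse form blocks are lifts of the GRADED stripped words
  have e0 : ((((1 : Matrix l l ℝ) ⊗ₖ S).submatrix (e₂ l μ ρ₁).symm (e₂ l μ ρ₁).symm).toBlocks₁₁ + ((1 : Matrix l l ℝ) ⊗ₖ G₀)) = (1 : Matrix l l ℝ) ⊗ₖ (S.toBlocks₁₁ + G₀) := by
    rw [toBlocks₁₁_lift, kron_add]
  have e1 : ((((((1 : Matrix l l ℝ) ⊗ₖ L).submatrix (e₂ l μ ρ₁).symm id) * (c ⊗ₖ H₁) - (((1 : Matrix l l ℝ) ⊗ₖ S).submatrix (e₂ l μ ρ₁).symm (e₂ l μ ρ₁).symm) * (fromRows (c ⊗ₖ Q₁₁) (0 : Matrix (l × ρ₁) (l × ν) ℝ))) * (((1 : Matrix l l ℝ) ⊗ₖ I).submatrix id (e₂ l μ ρ₁).symm) - (((1 : Matrix l l ℝ) ⊗ₖ L).submatrix (e₂ l μ ρ₁).symm id) * (fromRows (c ⊗ₖ Q₁₁) (0 : Matrix (l × ρ₁) (l × ν) ℝ))ᵀ * (((1 : Matrix l l ℝ) ⊗ₖ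 S).submatrix (e₂ l μ ρ₁).symm (e₂ l μ ρ₁).symm)).toBlocks₁₁ + (c ⊗ₖ G₁)) = c ⊗ₖ (((L * H₁ - S * (fromRows Q₁₁ (0 : Matrix ρ₁ ν ℝ))) * I + L * (fromRows Q₁₁ (0 : Matrix ρ₁ ν ℝ))ᵀ * S).toBlocks₁₁ + G₁) := by
    simp only [Matrix.transpose_submatrix, kronecker_transpose', hc, Matrix.transpose_one, Matrix.transpose_mul, Matrix.transpose_transpose,
      Matrix.sub_mul, Matrix.mul_sub, Matrix.add_mul, Matrix.mul_add, Matrix.neg_mul, Matrix.mul_neg, Matrix.smul_mul, Matrix.mul_smul,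
      submatrix_id_mul, mul_submatrix_id, Matrix.submatrix_mul_equiv, Matrix.submatrix_submatrix, Function.comp_id, Function.id_comp,
      ← Matrix.mul_kronecker_mul, Matrix.one_mul, Matrix.mul_one, neg_mul, mul_neg, neg_neg, neg_kronecker_comm, add_lift, sub_lift, neg_lift,
      smul_lift, kron_add, kron_sub, kron_neg, kron_smul, toBlocks₁₁_lift, sub_neg_eq_add, Matrix.mul_assoc, smul_neg, neg_add_rev,
      fromRows_lift, fromRows_lift_zero]
  have e2 : ((((-(((((1 : Matrix l l ℝ) ⊗ₖ L).submatrix (e₂ l μ ρ₁).symm id) * (c ⊗ₖ H₁) - (((1 : Matrix l l ℝ) ⊗ₖ S).submatrix (e₂ l μ ρ₁).symm (e₂ l μ ρ₁).symm) * (fromRows (c ⊗ₖ Q₁₁) (0 : Matrix (l × ρ₁) (l × ν) ℝ))) * ((1 : Matrix l l ℝ) ⊗ₖ Γ) + (((1 : Matrix l l ℝ) ⊗ₖ L).submatrix (e₂ l μ ρ₁).symm id) * (fromRows (c ⊗ₖ Q₁₁) (0 : Matrix (l × ρ₁) (l × ν) ℝ))ᵀ * (((1 : Matrix l l ℝ)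 ⊗ₖ L).submatrix (e₂ l μ ρ₁).symm id)) * (c ⊗ₖ H₁) + (((1 : Matrix l l ℝ) ⊗ₖ L).submatrix (e₂ l μ ρ₁).symm id) * ((c * c) ⊗ₖ H₂) - ((((((1 : Matrix l l ℝ) ⊗ₖ L).submatrix (e₂ l μ ρ₁).symm id) * (c ⊗ₖ H₁) - (((1 : Matrix l l ℝ) ⊗ₖ S).submatrix (e₂ l μ ρ₁).symm (e₂ l μ ρ₁).symm) * (fromRows (c ⊗ₖ Q₁₁) (0 : Matrix (l × ρ₁) (l × ν) ℝ))) * (((1 : Matrix l l ℝ) ⊗ₖ I).submatrix id (e₂ l μ ρ₁).symm) - (((1 : Matrix l l ℝ) ⊗ₖ L).submatrix (e₂ l μ ρ₁).symm id) * (fromRows (c ⊗ₖ Q₁₁) (0 : Matrix (l × ρ₁) (l × ν) ℝ))ᵀ * (((1 : Matrix l l ℝ) ⊗ₖ S).submatrix (e₂ l μ ρ₁).symm (e₂ l μ ρ₁).symm)) * (fromRows (c ⊗ₖ Q₁₁) (0 : Matrix (l × ρ₁) (l × ν) ℝ)) + (((1 : Matrix l l ℝ) ⊗ₖ S).submatrix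 (e₂ l μ ρ₁).symm (e₂ l μ ρ₁).symm) * (fromRows ((c * c) ⊗ₖ Q₁₂) (0 : Matrix (l × ρ₁) (l × ν) ℝ)))) * (((1 : Matrix l l ℝ) ⊗ₖ I).submatrix id (e₂ l μ ρ₁).symm) + ((((1 : Matrix l l ℝ) ⊗ₖ L).submatrix (e₂ l μ ρ₁).symm id) * (c ⊗ₖ H₁) - (((1 : Matrix l l ℝ) ⊗ₖ S).submatrix (e₂ l μ ρ₁).symm (e₂ l μ ρ₁).symm) * (fromRows (c ⊗ₖ Q₁₁) (0 : Matrix (l × ρ₁) (l × ν) ℝ))) * (-((((1 : Matrix l l ℝ) ⊗ₖ Γ) * (c ⊗ₖ H₁) + (((1 : Matrix l l ℝ) ⊗ₖ I).submatrix id (e₂ l μ ρ₁).symm) * (fromRows (c ⊗ₖ Q₁₁) (0 : Matrix (l × ρ₁) (l × ν) ℝ))) * (((1 : Matrix l l ℝ) ⊗ₖ I).submatrix id (e₂ l μ ρ₁).symm) - ((1 : Matrix l l ℝ) ⊗ₖ Γ) * (fromRows (c ⊗ₖ Q₁₁) (0 : Matrix (l × ρ₁) (l × ν) ℝ))ᵀ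 * (((1 : Matrix l l ℝ) ⊗ₖ S).submatrix (e₂ l μ ρ₁).symm (e₂ l μ ρ₁).symm)))) - ((-(((((1 : Matrix l l ℝ) ⊗ₖ L).submatrix (e₂ l μ ρ₁).symm id) * (c ⊗ₖ H₁) - (((1 : Matrix l l ℝ) ⊗ₖ S).submatrix (e₂ l μ ρ₁).symm (e₂ l μ ρ₁).symm) * (fromRows (c ⊗ₖ Q₁₁) (0 : Matrix (l × ρ₁) (l × ν) ℝ))) * ((1 : Matrix l l ℝ) ⊗ₖ Γ) + (((1 : Matrix l l ℝ) ⊗ₖ L).submatrix (e₂ l μ ρ₁).symm id) * (fromRows (c ⊗ₖ Q₁₁) (0 : Matrix (l × ρ₁) (l × ν) ℝ))ᵀ * (((1 : Matrix l l ℝ) ⊗ₖ L).submatrix (e₂ l μ ρ₁).symm id)) * (fromRows (c ⊗ₖ Q₁₁) (0 : Matrix (l × ρ₁) (l × ν) ℝ))ᵀ + (((1 : Matrix l l ℝ) ⊗ₖ L).submatrix (e₂ l μ ρ₁).symm id) * ((fromRows ((c * c) ⊗ₖ Q₁₂) (0 : Matrix (l × ρ₁) (l × ν) ℝ)))ᵀ)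 * (((1 : Matrix l l ℝ) ⊗ₖ S).submatrix (e₂ l μ ρ₁).symm (e₂ l μ ρ₁).symm) + (((1 : Matrix l l ℝ) ⊗ₖ L).submatrix (e₂ l μ ρ₁).symm id) * (fromRows (c ⊗ₖ Q₁₁) (0 : Matrix (l × ρ₁) (l × ν) ℝ))ᵀ * (((((1 : Matrix l l ℝ) ⊗ₖ L).submatrix (e₂ l μ ρ₁).symm id) * (c ⊗ₖ H₁) - (((1 : Matrix l l ℝ) ⊗ₖ S).submatrix (e₂ l μ ρ₁).symm (e₂ l μ ρ₁).symm) * (fromRows (c ⊗ₖ Q₁₁) (0 : Matrix (l × ρ₁) (l × ν) ℝ))) * (((1 : Matrix l l ℝ) ⊗ₖ I).submatrix id (e₂ l μ ρ₁).symm) - (((1 : Matrix l l ℝ) ⊗ₖ L).submatrix (e₂ l μ ρ₁).symm id) * (fromRows (c ⊗ₖ Q₁₁) (0 : Matrix (l × ρ₁) (l × ν) ℝ))ᵀ * (((1 : Matrix l l ℝ) ⊗ₖ S).submatrix (e₂ l μ ρ₁).symm (e₂ l μ ρ₁).symm)))).toBlocks₁₁ + ((c * c) ⊗ₖ G₂))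 = (c * c) ⊗ₖ ((((-((L * H₁ - S * (fromRows Q₁₁ (0 : Matrix ρ₁ ν ℝ))) * Γ - L * (fromRows Q₁₁ (0 : Matrix ρ₁ ν ℝ))ᵀ * L) * H₁ + L * H₂ - (((L * H₁ - S * (fromRows Q₁₁ (0 : Matrix ρ₁ ν ℝ))) * I + L * (fromRows Q₁₁ (0 : Matrix ρ₁ ν ℝ))ᵀ * S) * (fromRows Q₁₁ (0 : Matrix ρ₁ ν ℝ)) + S * fromRows Q₁₂ (0 : Matrix ρ₁ ν ℝ))) * I + (L * H₁ - S * (fromRows Q₁₁ (0 : Matrix ρ₁ ν ℝ))) * (-((Γ * H₁ + I * (fromRows Q₁₁ (0 : Matrix ρ₁ ν ℝ))) * I + Γ * (fromRows Q₁₁ (0 : Matrix ρ₁ ν ℝ))ᵀ * S))) - ((-((L * H₁ - S * (fromRows Q₁₁ (0 : Matrix ρ₁ ν ℝ))) * Γ - L * (fromRows Q₁₁ (0 : Matrix ρ₁ ν ℝ))ᵀ * L) * (-(fromRows Q₁₁ (0 : Matrix ρ₁ ν ℝ))ᵀ) + L * (fromRows Q₁₂ (0 : Matrix ρ₁ ν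 ℝ))ᵀ) * S + L * (-(fromRows Q₁₁ (0 : Matrix ρ₁ ν ℝ))ᵀ) * ((L * H₁ - S * (fromRows Q₁₁ (0 : Matrix ρ₁ ν ℝ))) * I + L * (fromRows Q₁₁ (0 : Matrix ρ₁ ν ℝ))ᵀ * S))).toBlocks₁₁ + G₂) := by
    simp only [Matrix.transpose_submatrix, kronecker_transpose', hc, Matrix.transpose_one, Matrix.transpose_mul, Matrix.transpose_transpose,
      Matrix.sub_mul, Matrix.mul_sub, Matrix.add_mul, Matrix.mul_add, Matrix.neg_mul, Matrix.mul_neg, Matrix.smul_mul, Matrix.mul_smul,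
      submatrix_id_mul, mul_submatrix_id, Matrix.submatrix_mul_equiv, Matrix.submatrix_submatrix, Function.comp_id, Function.id_comp,
      ← Matrix.mul_kronecker_mul, Matrix.one_mul, Matrix.mul_one, neg_mul, mul_neg, neg_neg, neg_kronecker_comm, add_lift, sub_lift, neg_lift,
      smul_lift, kron_add, kron_sub, kron_neg, kron_smul, toBlocks₁₁_lift, sub_neg_eq_add, Matrix.mul_assoc, smul_neg, neg_add_rev,
      fromRows_lift, fromRows_lift_zero]
    congr 3
    abel
  rw [e0, e1, e2] at main
  -- the Faddeev–Popov 2-jets are re-indexed lifts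
  have f0 : (((1 : Matrix l l ℝ) ⊗ₖ P).submatrix (e₂ l ρ₂ ρ₁).symm id) * (((1 : Matrix l l ℝ) ⊗ₖ W₀).submatrix id (e₂ l ρ₂ ρ₁).symm) = ((1 : Matrix l l ℝ) ⊗ₖ (P * W₀)).submatrix (e₂ l ρ₂ ρ₁).symm (e₂ l ρ₂ ρ₁).symm := by
    simp only [Matrix.transpose_submatrix, kronecker_transpose', hc, Matrix.transpose_one, Matrix.transpose_mul, Matrix.transpose_transpose,
      Matrix.sub_mul, Matrix.mul_sub, Matrix.add_mul, Matrix.mul_add, Matrix.neg_mul, Matrix.mul_neg, Matrix.smul_mul, Matrix.mul_smul,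
      submatrix_id_mul, mul_submatrix_id, Matrix.submatrix_mul_equiv, Matrix.submatrix_submatrix, Function.comp_id, Function.id_comp,
      ← Matrix.mul_kronecker_mul, Matrix.one_mul, Matrix.mul_one, neg_mul, mul_neg, neg_neg, neg_kronecker_comm, add_lift, sub_lift, neg_lift,
      smul_lift, kron_add, kron_sub, kron_neg, kron_smul, toBlocks₁₁_lift, sub_neg_eq_add, Matrix.mul_assoc, smul_neg, neg_add_rev,
      fromRows_lift, fromRows_lift_zero]
  have f1 : (((1 : Matrix l l ℝ) ⊗ₖ P).submatrix (e₂ l ρ₂ ρ₁).symm id) * ((c ⊗ₖ W₁).submatrix id (e₂ l ρ₂ ρ₁).symm) = (c ⊗ₖ (P * W₁)).submatrix (e₂ l ρ₂ ρ₁).symm (e₂ l ρ₂ ρ₁).symm := by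
    simp only [Matrix.transpose_submatrix, kronecker_transpose', hc, Matrix.transpose_one, Matrix.transpose_mul, Matrix.transpose_transpose,
      Matrix.sub_mul, Matrix.mul_sub, Matrix.add_mul, Matrix.mul_add, Matrix.neg_mul, Matrix.mul_neg, Matrix.smul_mul, Matrix.mul_smul,
      submatrix_id_mul, mul_submatrix_id, Matrix.submatrix_mul_equiv, Matrix.submatrix_submatrix, Function.comp_id, Function.id_comp,
      ← Matrix.mul_kronecker_mul, Matrix.one_mul, Matrix.mul_one, neg_mul, mul_neg, neg_neg, neg_kronecker_comm, add_lift, sub_lift, neg_lift,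
      smul_lift, kron_add, kron_sub, kron_neg, kron_smul, toBlocks₁₁_lift, sub_neg_eq_add, Matrix.mul_assoc, smul_neg, neg_add_rev,
      fromRows_lift, fromRows_lift_zero]
  have f2 : (((1 : Matrix l l ℝ) ⊗ₖ P).submatrix (e₂ l ρ₂ ρ₁).symm id) * (((c * c) ⊗ₖ W₂).submatrix id (e₂ l ρ₂ ρ₁).symm) = ((c * c) ⊗ₖ (P * W₂)).submatrix (e₂ l ρ₂ ρ₁).symm (e₂ l ρ₂ ρ₁).symm := by
    simp only [Matrix.transpose_submatrix, kronecker_transpose', hc, Matrix.transpose_one, Matrix.transpose_mul, Matrix.transpose_transpose,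
      Matrix.sub_mul, Matrix.mul_sub, Matrix.add_mul, Matrix.mul_add, Matrix.neg_mul, Matrix.mul_neg, Matrix.smul_mul, Matrix.mul_smul,
      submatrix_id_mul, mul_submatrix_id, Matrix.submatrix_mul_equiv, Matrix.submatrix_submatrix, Function.comp_id, Function.id_comp,
      ← Matrix.mul_kronecker_mul, Matrix.one_mul, Matrix.mul_one, neg_mul, mul_neg, neg_neg, neg_kronecker_comm, add_lift, sub_lift, neg_lift,
      smul_lift, kron_add, kron_sub, kron_neg, kron_smul, toBlocks₁₁_lift, sub_neg_eq_add, Matrix.mul_assoc, smul_neg, neg_add_rev,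
      fromRows_lift, fromRows_lift_zero]
  have g0 : fromRows (((1 : Matrix l l ℝ) ⊗ₖ τ₂) * ((1 : Matrix l l ℝ) ⊗ₖ Q₁₀)) ((1 : Matrix l l ℝ) ⊗ₖ τ₁) * (((1 : Matrix l l ℝ) ⊗ₖ W₀).submatrix id (e₂ l ρ₂ ρ₁).symm) = ((1 : Matrix l l ℝ) ⊗ₖ (fromRows (τ₂ * Q₁₀) τ₁ * W₀)).submatrix (e₂ l ρ₂ ρ₁).symm (e₂ l ρ₂ ρ₁).symm := by
    simp only [Matrix.transpose_submatrix, kronecker_transpose', hc, Matrix.transpose_one, Matrix.transpose_mul, Matrix.transpose_transpose,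
      Matrix.sub_mul, Matrix.mul_sub, Matrix.add_mul, Matrix.mul_add, Matrix.neg_mul, Matrix.mul_neg, Matrix.smul_mul, Matrix.mul_smul,
      submatrix_id_mul, mul_submatrix_id, Matrix.submatrix_mul_equiv, Matrix.submatrix_submatrix, Function.comp_id, Function.id_comp,
      ← Matrix.mul_kronecker_mul, Matrix.one_mul, Matrix.mul_one, neg_mul, mul_neg, neg_neg, neg_kronecker_comm, add_lift, sub_lift, neg_lift,
      smul_lift, kron_add, kron_sub, kron_neg, kron_smul, toBlocks₁₁_lift, sub_neg_eq_add, Matrix.mul_assoc, smul_neg, neg_add_rev,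
      fromRows_lift, fromRows_lift_zero]
  have g1 : fromRows (((1 : Matrix l l ℝ) ⊗ₖ τ₂) * (c ⊗ₖ Q₁₁)) (0 : Matrix (l × ρ₁) (l × ν) ℝ) * (((1 : Matrix l l ℝ) ⊗ₖ W₀).submatrix id (e₂ l ρ₂ ρ₁).symm) + fromRows (((1 : Matrix l l ℝ) ⊗ₖ τ₂) * ((1 : Matrix l l ℝ) ⊗ₖ Q₁₀)) ((1 : Matrix l l ℝ) ⊗ₖ τ₁) * ((c ⊗ₖ W₁).submatrix id (e₂ l ρ₂ ρ₁).symm) = (c ⊗ₖ (fromRows (τ₂ * Q₁₁) (0 : Matrix ρ₁ ν ℝ) * W₀ + fromRows (τ₂ * Q₁₀) τ₁ * W₁)).submatrix (e₂ l ρ₂ ρ₁).symm (e₂ l ρ₂ ρ₁).symm := by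
    simp only [Matrix.transpose_submatrix, kronecker_transpose', hc, Matrix.transpose_one, Matrix.transpose_mul, Matrix.transpose_transpose,
      Matrix.sub_mul, Matrix.mul_sub, Matrix.add_mul, Matrix.mul_add, Matrix.neg_mul, Matrix.mul_neg, Matrix.smul_mul, Matrix.mul_smul,
      submatrix_id_mul, mul_submatrix_id, Matrix.submatrix_mul_equiv, Matrix.submatrix_submatrix, Function.comp_id, Function.id_comp,
      ← Matrix.mul_kronecker_mul, Matrix.one_mul, Matrix.mul_one, neg_mul, mul_neg, neg_neg, neg_kronecker_comm, add_lift, sub_lift, neg_lift,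
      smul_lift, kron_add, kron_sub, kron_neg, kron_smul, toBlocks₁₁_lift, sub_neg_eq_add, Matrix.mul_assoc, smul_neg, neg_add_rev,
      fromRows_lift, fromRows_lift_zero]
  have g2 : fromRows (((1 : Matrix l l ℝ) ⊗ₖ τ₂) * ((c * c) ⊗ₖ Q₁₂)) (0 : Matrix (l × ρ₁) (l × ν) ℝ) * (((1 : Matrix l l ℝ) ⊗ₖ W₀).submatrix id (e₂ l ρ₂ ρ₁).symm) + fromRows (((1 : Matrix l l ℝ) ⊗ₖ τ₂) * (c ⊗ₖ Q₁₁)) (0 : Matrix (l × ρ₁) (l × ν) ℝ) * ((c ⊗ₖ W₁).submatrix id (e₂ l ρ₂ ρ₁).symm) + (fromRows (((1 : Matrix l l ℝ) ⊗ₖ τ₂) * (c ⊗ₖ Q₁₁)) (0 : Matrix (l × ρ₁) (l × ν) ℝ) * ((c ⊗ₖ W₁).submatrix id (e₂ l ρ₂ ρ₁).symm) + fromRows (((1 : Matrix l l ℝ) ⊗ₖ τ₂) * ((1 : Matrix l l ℝ) ⊗ₖ Q₁₀)) ((1 : Matrix l l ℝ) ⊗ₖ τ₁) * (((c * c) ⊗ₖ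 W₂).submatrix id (e₂ l ρ₂ ρ₁).symm))
      = ((c * c) ⊗ₖ (fromRows (τ₂ * Q₁₂) (0 : Matrix ρ₁ ν ℝ) * W₀ + fromRows (τ₂ * Q₁₁) (0 : Matrix ρ₁ ν ℝ) * W₁ + (fromRows (τ₂ * Q₁₁) (0 : Matrix ρ₁ ν ℝ) * W₁ + fromRows (τ₂ * Q₁₀) τ₁ * W₂))).submatrix (e₂ l ρ₂ ρ₁).symm (e₂ l ρ₂ ρ₁).symm := by
    simp only [Matrix.transpose_submatrix, kronecker_transpose', hc, Matrix.transpose_one, Matrix.transpose_mul, Matrix.transpose_transpose,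
      Matrix.sub_mul, Matrix.mul_sub, Matrix.add_mul, Matrix.mul_add, Matrix.neg_mul, Matrix.mul_neg, Matrix.smul_mul, Matrix.mul_smul,
      submatrix_id_mul, mul_submatrix_id, Matrix.submatrix_mul_equiv, Matrix.submatrix_submatrix, Function.comp_id, Function.id_comp,
      ← Matrix.mul_kronecker_mul, Matrix.one_mul, Matrix.mul_one, neg_mul, mul_neg, neg_neg, neg_kronecker_comm, add_lift, sub_lift, neg_lift,
      smul_lift, kron_add, kron_sub, kron_neg, kron_smul, toBlocks₁₁_lift, sub_neg_eq_add, Matrix.mul_assoc, smul_neg, neg_add_rev,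
      fromRows_lift, fromRows_lift_zero]
  rw [f0, f1, f2, g0, g1, g2, secondVar_submatrix_equiv, secondVar_submatrix_equiv, secondVar_kronecker_lift, secondVar_kronecker_lift] at main
  -- the one-shot system: common re-indexing of the parameter rows, then strip; the fine and coarse systems strip directly
  have z0 : (0 : Matrix ((l × ρ₂) ⊕ (l × ρ₁)) (l × ν) ℝ) = (0 : Matrix (l × (ρ₂ ⊕ ρ₁)) (l × ν) ℝ).submatrix (e₂ l ρ₂ ρ₁).symm id := rfl
  rw [z0, kkt_fromRows_submatrix, kkt_fromRows_submatrix, kkt_fromRows_submatrix, secondVar_submatrix_equiv,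
    secondVar_kkt_lift_strip_zeroSlice hc, secondVar_kkt_lift_strip_zeroSlice hc, secondVar_kkt_lift_strip_zeroSlice hc] at main
  refine mul_left_cancel₀ htr ?_
  linear_combination main

end Graded

end Summit.QuantumFields.BalabanUV.Beta.FP.NestedStepLawOneShotJetsGraded

end
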